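import Summits.CriticalPhenomena.PercolationContinuityZ3.Theorems.FK.FKCriticalValueSquareLattice
import Summits.CriticalPhenomena.PercolationContinuityZ3.Theorems.FK.DecayRatesBelowFiniteVolumeThreshold
import Summits.CriticalPhenomena.PercolationContinuityZ3.Theorems.FK.UniquenessBelowFiniteVolumeThreshold
import Summits.CriticalPhenomena.PercolationContinuityZ3.Theorems.FK.ClusterMomentsBelowFiniteVolumeThreshold
import HarnessLib

/-!
# The whole subcritical phase of the random-cluster model on `ℤ^d` is "below the finite-volume threshold":
# `p̃_c^2(q) = p_c(q)` — exponential decay of the VOLUME, positive decay rates, finite moments, uniqueness, for EVERY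
# `p < p_c(q)`, `q ≥ 1`, `d ≥ 2` (Grimmett 2006 Thm (5.86); Conj. (5.54), (5.59), (5.85) — via DRT sharpness)

Claimed R42 (8)(c) in the cell INBOX at 2026-08-28T02:11:55Z by fkp-10a gen 352 (NEW CLAIM #2 of the gen), addressed to coordinator fk-4 g266 (seated 01:27Z 2026-08-28; R146 l.8252: row FO-10a-g352 = package g352-osss; its (κ) clause sends the FK instantiation to a new claim, R147); lineage row FO-10a-g352f (self-suggested), package g352-fkosss, label FS-I.
Support file of the `fk-continuity` cell (lineage fkp-10a, `--supports stmt-CriticalPhenomena-4575`); builds on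
p205010 (kernel theorem, internal audit signed; external expert review pending).  No definitions, no named facts,
no sorries; standard axioms.  Package `g352-fkosss` = THE FK INSTANTIATION of the OSSS inequality for monotonic measures
(row FO-10a-g352 `g352-osss`): Duminil-Copin–Raoufi–Tassion's Theorem 1.2 (sharpness of the random-cluster phase
transition on `ℤ^d`, `q ≥ 1`) and, on `ℤ²`, `p_c(q) = √q/(1+√q)`.  UNCONDITIONAL; nothing here touches FH / TP_FK / the
`_r3` binders of the cell.  ADDENDUM v2 of CLAIM #2 (ninth file, label FS-I).

Grimmett's Theorem (5.86) (Kesten's block argument; the lineage's `g350-volexp` files VX-C…VX-H) derives exponential decay of the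
cluster volume, positive volume / radius / two-point decay rates, all moments of `|C_0|`, uniqueness `φ⁰_{p,q} = φ¹_{p,q}` and
`h⁰ = h¹` from the FINITE-VOLUME HYPOTHESIS `L²(p,q) = 0`: `n^{d−1} φ¹_{Λ_{2n},p,q}(0 ↔ ∂Λ_n) → 0`.  SHARPNESS (`FKSharpnessOSSS.lean`,
DRT 2019 Thm 1.2: `φ¹_{Λ_{2n},p,q}(0 ↔ ∂Λ_n) ≤ e^{−cn}` for `p < p_c(q)`) discharges that hypothesis for EVERY `p < p_c(q)`
(`tendsto_pow_mul_thetaBox_of_lt_rcCriticalProb`), so all those conclusions hold on the whole subcritical phase (`d ≥ 2`,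
`q ≥ 1`) — i.e. `p̃_c²(q) = p̃_c(q) = p_c(q)` (Grimmett's Conj. (5.59) «p̃_c(q) = p_c(q)» and, with it, Conj. (5.85)
«p̃_c^∞(q) = p̃_c(q)») and Conj. (5.54) «ψ(p,q) > 0 and ζ(p,q) > 0 whenever p < p_c(q)» in full:
`FKGibbs.exists_real_clusterSizeGe_le_exp_of_lt_rcCriticalProb` (volume: `P(|C_0| ≥ n) ≤ K e^{−cn}`),
`IsBoxLimit.exists_decayRate_pos_of_lt_rcCriticalProb` (two-point function: `φ^b_{p,q}(0 ↔ nu) ≤ e^{−nψ}`, `ψ > 0`, every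
direction `u`), `…volumeDecayRate_pos…` (`ζ > 0`), `…radiusDecayRate_pos…`, `FKGibbs.integrable_ncard_pow_of_lt_rcCriticalProb`
(all moments); and on `ℤ²` the volume decay for every `p < √q/(1+√q)`.  Uniqueness `FKGibbs d p q P ↔ P = φ⁰_{p,q}` and
`h⁰ = h¹` below `p_c(q)` are ALREADY in the tree for every `d` (via `θ¹ = 0` below `p_c` and Grimmett Thm (5.33)):
`Summit.CriticalPhenomena.PercolationContinuityZ3.Theorems.FK.fkGibbs_iff_eq_rcLimit_false_of_lt_rcCriticalProb` and
`….FK.freeEdgeDensity_eq_wiredEdgeDensity_of_lt_rcCriticalProb` (`UniquenessOfNonPercolationTheta.lean`) — cited, not restated.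
No definitions.

## References
* G. Grimmett, *The Random-Cluster Model*, Springer 2006, §5.5 Conj. (5.54), (5.57)–(5.59), §5.6 (5.83)–(5.86), Thm (5.33). [Grimmett2006]
* H. Duminil-Copin, A. Raoufi, V. Tassion, Ann. of Math. 189 (2019) 75–99, Thm 1.2 and its corollaries. [DuminilCopinRaoufiTassion2019]
-/

noncomputable section

namespace Summit.CriticalPhenomena.PercolationContinuityZ3.Theorems.FK

namespace MonotonicOSSS

open MeasureTheory Finset Function Filter Topology Set
open Literature.Probability.Percolation Literature.Probability.LatticeModels Literature.Barriers.CriticalPhenomena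
open Literature.Probability.Percolation.DCT16

variable {d : ℕ} {p q : ℝ} {P : Measure (BondConfig (Site d))} {b : Bool}

/-- **`L²(p,q) = 0` ON THE WHOLE SUBCRITICAL PHASE**: for `d ≥ 2`, `q ≥ 1`, `0 ≤ p < p_c(q)`,
`n^{d−1} φ¹_{Λ_{2n},p,q}(0 ↔ ∂Λ_n) → 0` (indeed exponentially fast) — the hypothesis of Grimmett's Thm (5.86) with `a = 2`;
equivalently `p̃_c^2(q) = p_c(q)`. [cite: DuminilCopinRaoufiTassion2019, Thm 1.2 (1) (θ_n(β) ≤ exp(−cn) for β < β_c)] -/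
theorem tendsto_pow_mul_thetaBox_of_lt_rcCriticalProb (hd : 2 ≤ d) (hp : p ∈ Set.Icc (0 : ℝ) 1) (hq : 1 ≤ q)
    (hpc : p < rcCriticalProb d q) :
    Tendsto (fun n : ℕ => (n : ℝ) ^ (d - 1) * regionWiredReal d p q (box d (2 * n)) (siteToBoundary d n)) atTop (𝓝 0) := by
  have hpc1 : rcCriticalProb d q < 1 := rcCriticalProb_lt_one hd hq
  set p' : ℝ := (p + rcCriticalProb d q) / 2 with hp'
  have hp'0 : 0 < p' := by rw [hp']; linarith [rcCriticalProb_pos (by omega : 1 ≤ d) hq, hp.1]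
  have hp'c : p' < rcCriticalProb d q := by rw [hp']; linarith
  have hpp' : p ≤ p' := by rw [hp']; linarith
  have hp'I : p' ∈ Set.Icc (0 : ℝ) 1 := ⟨hp'0.le, (hp'c.trans hpc1).le⟩
  obtain ⟨c, hc, hdec⟩ := exists_exp_decay_thetaBox_of_lt_rcCriticalProb hd hq hp'0 hp'c
  have hlim := tendsto_pow_mul_exp_neg_mul_atTop (d - 1) hc
  refine squeeze_zero' (Filter.Eventually.of_forall fun n => mul_nonneg (by positivity) measureReal_nonneg) ?_ hlim
  filter_upwards [Filter.eventually_ge_atTop 1] with n hn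
  exact mul_le_mul_of_nonneg_left ((regionWiredReal_siteToBoundary_mono_left hp hp'I hpp' hq _ _).trans (hdec n hn))
    (by positivity)

/-- **EXPONENTIAL DECAY OF THE CLUSTER VOLUME THROUGHOUT THE SUBCRITICAL PHASE**: for `d ≥ 2`, `q ≥ 1`, `0 ≤ p < p_c(q)` and every
FK-Gibbs measure `P` at `(p,q)`: `∃ c > 0, K > 0, ∀ n ≥ 1, P(|C_0| ≥ n) ≤ K e^{−cn}`.
[cite: Grimmett2006, Thm (5.86) (exponential volume decay below p̃_c) with Conj. (5.59) (p̃_c = p_c)] -/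
theorem FKGibbs.exists_real_clusterSizeGe_le_exp_of_lt_rcCriticalProb (hP : FKGibbs d p q P) (hd : 2 ≤ d)
    (hp : p ∈ Set.Icc (0 : ℝ) 1) (hq : 1 ≤ q) (hpc : p < rcCriticalProb d q) :
    ∃ c : ℝ, 0 < c ∧ ∃ K : ℝ, 0 < K ∧ ∀ n : ℕ, 1 ≤ n →
      P.real (clusterSizeGe (0 : Site d) n) ≤ K * Real.exp (-(c * n)) :=
  hP.exists_real_clusterSizeGe_le_exp_of_tendsto (by omega) hp hq (by norm_num)
    (tendsto_pow_mul_thetaBox_of_lt_rcCriticalProb hd hp hq hpc)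

/-- **ALL MOMENTS OF `|C_0|` ARE FINITE BELOW `p_c(q)`** for every FK-Gibbs measure (`d ≥ 2`, `q ≥ 1`).
[cite: Grimmett2006, Thm (5.86) with Conj. (5.59) (p̃_c = p_c)] -/
theorem FKGibbs.integrable_ncard_pow_of_lt_rcCriticalProb (hP : FKGibbs d p q P) (hd : 2 ≤ d)
    (hp : p ∈ Set.Icc (0 : ℝ) 1) (hq : 1 ≤ q) (hpc : p < rcCriticalProb d q) (k : ℕ) :
    Integrable (fun ω : BondConfig (Site d) => (((openCluster ω 0).ncard : ℕ) : ℝ) ^ k) P :=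
  hP.integrable_ncard_pow_of_tendsto (by omega) hp hq (by norm_num) (tendsto_pow_mul_thetaBox_of_lt_rcCriticalProb hd hp hq hpc) k

/-- **EXPONENTIAL DECAY OF THE TWO-POINT FUNCTION BELOW `p_c(q)` (Grimmett's Conjecture (5.54), `ψ(p,q) > 0 whenever
p < p_c(q)`)**: for the box limits
`φ^b_{p,q}` (`d ≥ 2`, `q ≥ 1`, `0 < p < p_c(q)`) and every `u ≠ 0` there is `ψ = ψ(u) > 0` with
`φ^b_{p,q}(0 ↔ nu) ≤ e^{−nψ}` for all `n`, `ψ` being the limit of `−log φ^b(0 ↔ nu)/n`.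
[cite: Grimmett2006, Conj. (5.54) (ψ > 0 below p_c) via Thm (5.86) (ψ > 0 below p̃_c)] -/
theorem IsBoxLimit.exists_decayRate_pos_of_lt_rcCriticalProb (hd : 2 ≤ d) (hP : IsBoxLimit d b p q P)
    (hp : p ∈ Set.Ioc (0 : ℝ) 1) (hq : 1 ≤ q) (hpc : p < rcCriticalProb d q) {u : Site d} (hu : u ≠ 0) :
    ∃ ψ : ℝ, 0 < ψ ∧ ψ ≤ -Real.log (P.real (openConn (0 : Site d) u)) ∧
      Tendsto (fun n : ℕ => -Real.log (P.real (openConn (0 : Site d) (n • u))) / n) atTop (𝓝 ψ) ∧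
      ∀ n : ℕ, P.real (openConn (0 : Site d) (n • u)) ≤ Real.exp (-(n * ψ)) :=
  hP.exists_decayRate_pos_of_tendsto (by omega) hp hq (by norm_num)
    (tendsto_pow_mul_thetaBox_of_lt_rcCriticalProb hd ⟨hp.1.le, hp.2⟩ hq hpc) hu

/-- **POSITIVE VOLUME DECAY RATE `ζ(p,q) > 0` BELOW `p_c(q)`** for the box limits (`d ≥ 2`, `q ≥ 1`, `0 < p < p_c(q)`, `p < 1`).
[cite: Grimmett2006, Conj. (5.54) (ζ > 0 below p_c) via Thm (5.86) (ζ > 0 below p̃_c)] -/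
theorem IsBoxLimit.exists_volumeDecayRate_pos_of_lt_rcCriticalProb (hd : 2 ≤ d) (hP : IsBoxLimit d b p q P)
    (hp : p ∈ Set.Ioo (0 : ℝ) 1) (hq : 1 ≤ q) (hpc : p < rcCriticalProb d q) :
    ∃ ζ : ℝ, 0 < ζ ∧
      Tendsto (fun n : ℕ => -(1 / (n : ℝ)) * Real.log (P.real {ω : BondConfig (Site d) | (openCluster ω 0).ncard = n}))
        atTop (𝓝 ζ) ∧
      ∀ n : ℕ, 1 ≤ n → P.real {ω : BondConfig (Site d) | (openCluster ω 0).ncard = n} ≤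
        q * (1 - p) / p * ((2 * n + 1) ^ d : ℕ) * Real.exp (-(n * ζ)) :=
  hP.exists_volumeDecayRate_pos_of_tendsto (by omega) hp hq (by norm_num)
    (tendsto_pow_mul_thetaBox_of_lt_rcCriticalProb hd ⟨hp.1.le, hp.2.le⟩ hq hpc)

/-- **THE RADIUS DECAY RATE `ψ^b(p,q) > 0` BELOW `p_c(q)`** for the box limits (finite correlation length `ξ = 1/ψ` on the whole
subcritical phase): `ψ` is the common limit of `−n⁻¹ log φ^b(0 ↔ n e_k)` and `−n⁻¹ log φ^b(0 ↔ ∂Λ_n)`, with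
`φ^b(0 ↔ n e_k) ≤ e^{−nψ}` and `φ^b(0 ↔ ∂Λ_n) ≤ 2d(2n+1)^{d−1} e^{−nψ}`.
[cite: Grimmett2006, Conj. (5.54) via Thm (5.86) (radius decay rate below p̃_c)] -/
theorem IsBoxLimit.exists_radiusDecayRate_pos_of_lt_rcCriticalProb (hd : 2 ≤ d) (hP : IsBoxLimit d b p q P)
    (hp : p ∈ Set.Ioc (0 : ℝ) 1) (hq : 1 ≤ q) (hpc : p < rcCriticalProb d q) (k : Fin d) :
    ∃ ψ : ℝ, 0 < ψ ∧
      Tendsto (fun n : ℕ => -Real.log (P.real (openConn (0 : Site d) (n • (Pi.single k (1 : ℤ) : Site d)))) / n)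
        atTop (𝓝 ψ) ∧
      Tendsto (fun n : ℕ => -Real.log (P.real (siteToBoundary d n)) / n) atTop (𝓝 ψ) ∧
      (∀ n : ℕ, P.real (openConn (0 : Site d) (n • (Pi.single k (1 : ℤ) : Site d))) ≤ Real.exp (-(n * ψ))) ∧
      ∀ n : ℕ, P.real (siteToBoundary d n) ≤ 2 * d * (2 * n + 1) ^ (d - 1) * Real.exp (-(n * ψ)) :=
  hP.exists_radiusDecayRate_pos_of_tendsto (by omega) hp hq (by norm_num)
    (tendsto_pow_mul_thetaBox_of_lt_rcCriticalProb hd ⟨hp.1.le, hp.2⟩ hq hpc) k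

/-- **ON `ℤ²`, BELOW THE SELF-DUAL POINT**: for `q ≥ 1`, `0 ≤ p < √q/(1+√q)` and every FK-Gibbs measure at `(p,q)`, the cluster
volume has an exponential tail. [cite: DuminilCopinRaoufiTassion2019, Thm 1.3 with Thm 1.2] -/
theorem FKGibbs.exists_real_clusterSizeGe_le_exp_of_lt_selfDual {P : Measure (BondConfig (Site 2))} (hP : FKGibbs 2 p q P)
    (hp : p ∈ Set.Icc (0 : ℝ) 1) (hq : 1 ≤ q) (hpsd : p < Real.sqrt q / (1 + Real.sqrt q)) :
    ∃ c : ℝ, 0 < c ∧ ∃ K : ℝ, 0 < K ∧ ∀ n : ℕ, 1 ≤ n →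
      P.real (clusterSizeGe (0 : Site 2) n) ≤ K * Real.exp (-(c * n)) :=
  FKGibbs.exists_real_clusterSizeGe_le_exp_of_lt_rcCriticalProb hP le_rfl hp hq (by rwa [rcCriticalProb_two_eq hq])

end MonotonicOSSS

end Summit.CriticalPhenomena.PercolationContinuityZ3.Theorems.FK
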